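import Literature.Analysis.FunctionSpaces.TorusHardCoreCutoff
import Literature.Analysis.FunctionSpaces.TorusLipschitzMultiplierH1
import HarnessLib

/-!
# The kinetic cost of cutting off near the hard-core pair tubes

Analysis/FunctionSpaces support file (everything proved; no definitions, no named facts; global
`volume` convention of `FlatTorus`). For `η ∈ L²((ℝ/ℤ)^{N×3}; ℂ)` and the cut-off
`χ_δ = Torus.pairCutoff θ r δ` near the tubes `{ρᵢⱼ ≤ r}` (`TorusHardCoreCutoff`), the spectral kinetic
energy of `χ_δ η` in the direction `𝐞_{(i,k)}` is controlled by that of `η` plus collar integrals: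
with `C_{ij}(δ) = {r + δ/2 < ρᵢⱼ < r + 5δ/2}`, every `ε > 0` and `0 < δ`,

  `∑ₙ n_{(i,k)}² ‖𝓕(χ_δ η)(n)‖² ≤ (1+ε) ∑ₙ n_{(i,k)}² ‖η̂(n)‖²
      + (1+ε⁻¹)(4π²)⁻¹ · 25 K² N ∑ⱼ ∫⁻_{C_{ij}(δ)} ‖η‖² / (ρᵢⱼ - r)²`     (`Torus.tsum_sq_pairCutoff_mul_le`)

(the Leibniz estimate `Torus.tsum_sq_mul_enorm_mFourierCoeff_mul_le` with the directional modulus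
`Λᵢ = (2K/δ) ∑ⱼ 𝟙_{C_{ij}(δ)}` of `Torus.abs_pairCutoff_add_single_sub_le`, `(∑ⱼ 𝟙)² ≤ N ∑ⱼ 𝟙`, and
`4δ⁻² ≤ 25 (ρᵢⱼ - r)⁻²` on the collar), and the collar integrals tend to `0` with `δ → 0⁺` as soon
as `∫⁻_{r < ρᵢⱼ < 6r/5} ‖η‖²/(ρᵢⱼ - r)² < ∞` (`Torus.tendsto_collar_lintegral_zero`, dominated
convergence) — which is the tube Hardy inequality `Torus.lintegral_collar_div_sq_le`
(`TorusPairTubeHardy`) for `η` vanishing on the tube with finite kinetic energy. Together these give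
`limsup_{δ→0} ‖∂(χ_δ η)‖² ≤ (1+ε)‖∂η‖²` for every `ε`, the kinetic half of "cutting off at the hard
core costs nothing" (no Lavrentiev gap for hard-core Bose gases; LSSY 2005, Ch. 2).

Packaged for the hard-core maximal-form bound: `Torus.eventually_pairCutoff_regularization` — for
`η` vanishing a.e. on the closed tubes with finite tube-Hardy integrals and `ε > 0`, for all small
`δ > 0` every directional `H¹` sum of `χ_δ η` is `≤ (1+ε)` that of `η` `+ ε` and `∫⁻ ‖χ_δ η - η‖² ≤ ε`.

## Mathlib / tree search

Mathlib: `MeasureTheory.tendsto_lintegral_filter_of_dominated_convergence'`, `lintegral_finsetSum'`;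
nothing on hard cores. Tree: `TorusHardCoreCutoff`, `TorusLipschitzMultiplierH1`, `TorusPairDist`.

## References

* E. H. Lieb, R. Seiringer, J. P. Solovej, J. Yngvason, *The Mathematics of the Bose Gas and its
  Condensation*, Birkhäuser (2005), Ch. 2.
* V. Maz'ya, *Sobolev Spaces*, 2nd ed. (2011), §2.3.3.
-/

noncomputable section

open MeasureTheory Set Filter Function UnitAddTorus Metric Topology
open scoped ENNReal NNReal

namespace Literature.Analysis.FunctionSpaces

namespace Torus

variable {N : ℕ} {K : NNReal} {θ : ℝ → ℝ}

/-! ## The directional modulus of the cut-off, `[0, ∞]`-valued -/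

/-- Real differences read in `ℂ`: `‖↑a - ↑b‖ₑ ≤ ofReal B` when `|a - b| ≤ B`. [folklore] -/
theorem enorm_ofReal_sub_ofReal_le {a b B : ℝ} (h : |a - b| ≤ B) :
    ‖((a : ℝ) : ℂ) - ((b : ℝ) : ℂ)‖ₑ ≤ ENNReal.ofReal B := by
  rw [← Complex.ofReal_sub, ← ofReal_norm, Complex.norm_real, Real.norm_eq_abs]
  exact ENNReal.ofReal_le_ofReal h

/-- `ofReal` of a sum of real `0/1`-indicators is the sum of the `[0, ∞]`-valued indicators. [folklore] -/
theorem ofReal_sum_indicator_one {α ι : Type*} (S : Finset ι) (A : ι → Set α) (x : α) :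
    ENNReal.ofReal (∑ j ∈ S, (A j).indicator (fun _ => (1 : ℝ)) x) = ∑ j ∈ S, (A j).indicator (fun _ => (1 : ℝ≥0∞)) x := by
  rw [ENNReal.ofReal_sum_of_nonneg (fun j _ => indicator_nonneg (fun _ _ => zero_le_one) _)]
  refine Finset.sum_congr rfl fun j _ => ?_
  by_cases hj : x ∈ A j
  · rw [indicator_of_mem hj, indicator_of_mem hj, ENNReal.ofReal_one]
  · rw [indicator_of_notMem hj, indicator_of_notMem hj, ENNReal.ofReal_zero]

/-- **The modulus of the cut-off along `𝐞_{(i,k)}` for `|s| ≤ δ/2`**: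
`‖χ_δ(t + s𝐞_{(i,k)}) - χ_δ(t)‖ₑ ≤ |s| · (2/δ) ∑ⱼ 𝟙_{C_{ij}(δ)}(t)`,
`C_{ij}(δ) = {r + δ/2 < ρᵢⱼ < r + 5δ/2}`. [folklore] -/
theorem enorm_pairCutoff_add_single_sub_le (hθ : IsCutProfile K θ) {r δ : ℝ} (hδ : 0 < δ) (i : Fin N) (k : Fin 3)
    (t : UnitAddTorus (Fin N × Fin 3)) {s : ℝ} (hs : |s| ≤ δ / 2) :
    ‖((pairCutoff θ r δ (t + Pi.single (i, k) ((s : ℝ) : UnitAddCircle)) : ℝ) : ℂ) - (pairCutoff θ r δ t : ℂ)‖ₑ ≤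
      ENNReal.ofReal |s| * (ENNReal.ofReal (2 * K / δ) * ∑ j : Fin N,
        {t | r + δ / 2 < pairDist i j t ∧ pairDist i j t < r + 5 * δ / 2}.indicator (fun _ => (1 : ℝ≥0∞)) t) := by
  set S : ℝ := ∑ j : Fin N,
    {t | r + δ / 2 < pairDist i j t ∧ pairDist i j t < r + 5 * δ / 2}.indicator (fun _ => (1 : ℝ)) t with hS
  have hS0 : 0 ≤ S := Finset.sum_nonneg fun j _ => indicator_nonneg (fun _ _ => zero_le_one) _
  have h := abs_pairCutoff_add_single_sub_le (r := r) hθ hδ i t k s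
  -- enlarge the layers to `C_{ij}(δ)` using `|s| ≤ δ/2`
  have hsum : (∑ j : Fin N, if r + δ - |s| < pairDist i j t ∧ pairDist i j t < r + 2 * δ + |s|
      then (1 : ℝ) else 0) ≤ S := by
    refine Finset.sum_le_sum fun j _ => ?_
    split_ifs with hc
    · rw [indicator_of_mem (show t ∈ {t | r + δ / 2 < pairDist i j t ∧ pairDist i j t < r + 5 * δ / 2} from
        ⟨by linarith [hc.1], by linarith [hc.2]⟩)]
    · exact indicator_nonneg (fun _ _ => zero_le_one) _
  have hreal : |pairCutoff θ r δ (t + Pi.single (i, k) ((s : ℝ) : UnitAddCircle)) - pairCutoff θ r δ t| ≤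
      |s| * (2 * K / δ * S) := by
    refine h.trans ?_
    have hsδ : 0 ≤ K * (|s| / δ) := mul_nonneg K.coe_nonneg (div_nonneg (abs_nonneg _) hδ.le)
    calc K * (|s| / δ) * (2 * ∑ j : Fin N, if r + δ - |s| < pairDist i j t ∧ pairDist i j t < r + 2 * δ + |s|
          then (1 : ℝ) else 0) ≤ K * (|s| / δ) * (2 * S) := by gcongr
      _ = |s| * (2 * K / δ * S) := by ring
  have hK : 0 ≤ 2 * (K : ℝ) / δ := div_nonneg (mul_nonneg zero_le_two K.coe_nonneg) hδ.le
  refine (enorm_ofReal_sub_ofReal_le hreal).trans_eq ?_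
  rw [ENNReal.ofReal_mul (abs_nonneg _), ENNReal.ofReal_mul hK, hS, ofReal_sum_indicator_one]

/-! ## The modulus integral is a collar integral -/

/-- **`∫⁻ Λᵢ² ‖η‖² ≤ 25 K² N ∑ⱼ ∫⁻_{C_{ij}(δ)} ‖η‖²/(ρᵢⱼ - r)²`** for the modulus
`Λᵢ = (2K/δ) ∑ⱼ 𝟙_{C_{ij}(δ)}` (`(∑ⱼ 𝟙)² ≤ N ∑ⱼ 𝟙` and `4/δ² ≤ 25/(ρᵢⱼ - r)²` on `C_{ij}(δ)`;
`0 ≤ K` a real constant). [folklore] -/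
theorem lintegral_modulus_sq_mul_le {r δ : ℝ} (hδ : 0 < δ) {K : ℝ} (hK : 0 ≤ K) (i : Fin N)
    {η : UnitAddTorus (Fin N × Fin 3) → ℂ} (hη : AEStronglyMeasurable η volume) :
    ∫⁻ t, (ENNReal.ofReal (2 * K / δ) * ∑ j : Fin N,
        {t | r + δ / 2 < pairDist i j t ∧ pairDist i j t < r + 5 * δ / 2}.indicator (fun _ => (1 : ℝ≥0∞)) t) ^ 2 *
          ‖η t‖ₑ ^ 2 ≤
      (N : ℝ≥0∞) * (ENNReal.ofReal (25 * K ^ 2) *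
        ∑ j : Fin N, ∫⁻ t in {t | r + δ / 2 < pairDist i j t ∧ pairDist i j t < r + 5 * δ / 2},
          ‖η t‖ₑ ^ 2 / ENNReal.ofReal ((pairDist i j t - r) ^ 2)) := by
  set C : Fin N → Set (UnitAddTorus (Fin N × Fin 3)) := fun j =>
    {t | r + δ / 2 < pairDist i j t ∧ pairDist i j t < r + 5 * δ / 2} with hC_def
  have hCm : ∀ j, MeasurableSet (C j) := fun j =>
    (measurableSet_lt measurable_const (continuous_pairDist i j).measurable).inter
      (measurableSet_lt (continuous_pairDist i j).measurable measurable_const)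
  -- pointwise: `(c ∑ 𝟙)² ≤ c² N ∑ 𝟙`
  have hpt : ∀ t, (ENNReal.ofReal (2 * K / δ) * ∑ j, (C j).indicator (fun _ => (1 : ℝ≥0∞)) t) ^ 2 * ‖η t‖ₑ ^ 2 ≤
      (N : ℝ≥0∞) * ∑ j, (C j).indicator (fun t => ENNReal.ofReal (2 * K / δ) ^ 2 * ‖η t‖ₑ ^ 2) t := by
    intro t
    have hle : ∑ j, (C j).indicator (fun _ => (1 : ℝ≥0∞)) t ≤ N := by
      calc ∑ j, (C j).indicator (fun _ => (1 : ℝ≥0∞)) t ≤ ∑ _j : Fin N, (1 : ℝ≥0∞) :=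
            Finset.sum_le_sum fun j _ => indicator_le_self' (fun _ _ => zero_le) t |>.trans le_rfl
        _ = N := by simp
    have hsq : (∑ j, (C j).indicator (fun _ => (1 : ℝ≥0∞)) t) ^ 2 ≤ N * ∑ j, (C j).indicator (fun _ => (1 : ℝ≥0∞)) t := by
      rw [pow_two]
      exact mul_le_mul_left hle _
    have hind : ∀ j, (C j).indicator (fun t => ENNReal.ofReal (2 * K / δ) ^ 2 * ‖η t‖ₑ ^ 2) t =
        (C j).indicator (fun _ => (1 : ℝ≥0∞)) t * (ENNReal.ofReal (2 * K / δ) ^ 2 * ‖η t‖ₑ ^ 2) := by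
      intro j
      by_cases hj : t ∈ C j
      · rw [indicator_of_mem hj, indicator_of_mem hj, one_mul]
      · rw [indicator_of_notMem hj, indicator_of_notMem hj, zero_mul]
    simp_rw [hind, ← Finset.sum_mul]
    calc (ENNReal.ofReal (2 * K / δ) * ∑ j, (C j).indicator (fun _ => (1 : ℝ≥0∞)) t) ^ 2 * ‖η t‖ₑ ^ 2
        = (∑ j, (C j).indicator (fun _ => (1 : ℝ≥0∞)) t) ^ 2 * (ENNReal.ofReal (2 * K / δ) ^ 2 * ‖η t‖ₑ ^ 2) := by
          rw [mul_pow]; ring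
      _ ≤ (N * ∑ j, (C j).indicator (fun _ => (1 : ℝ≥0∞)) t) * (ENNReal.ofReal (2 * K / δ) ^ 2 * ‖η t‖ₑ ^ 2) :=
          mul_le_mul_left hsq _
      _ = _ := by ring
  -- integrate
  have hmeas : ∀ j ∈ Finset.univ, AEMeasurable ((C j).indicator fun t => ENNReal.ofReal (2 * K / δ) ^ 2 * ‖η t‖ₑ ^ 2)
      (volume : Measure (UnitAddTorus (Fin N × Fin 3))) := fun j _ =>
    ((hη.enorm.pow_const 2).const_mul _).indicator (hCm j)
  calc ∫⁻ t, (ENNReal.ofReal (2 * K / δ) * ∑ j, (C j).indicator (fun _ => (1 : ℝ≥0∞)) t) ^ 2 * ‖η t‖ₑ ^ 2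
      ≤ ∫⁻ t, (N : ℝ≥0∞) * ∑ j, (C j).indicator (fun t => ENNReal.ofReal (2 * K / δ) ^ 2 * ‖η t‖ₑ ^ 2) t :=
        lintegral_mono hpt
    _ = (N : ℝ≥0∞) * ∑ j, ∫⁻ t in C j, ENNReal.ofReal (2 * K / δ) ^ 2 * ‖η t‖ₑ ^ 2 := by
        rw [lintegral_const_mul' _ _ (ENNReal.natCast_ne_top N), lintegral_finsetSum' _ hmeas]
        congr 1
        exact Finset.sum_congr rfl fun j _ => lintegral_indicator (hCm j) _
    _ ≤ (N : ℝ≥0∞) * ∑ j, ENNReal.ofReal (25 * K ^ 2) *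
          ∫⁻ t in C j, ‖η t‖ₑ ^ 2 / ENNReal.ofReal ((pairDist i j t - r) ^ 2) := by
        gcongr with j
        rw [← lintegral_const_mul' _ _ ENNReal.ofReal_ne_top]
        refine setLIntegral_mono' (hCm j) fun t ht => ?_
        -- on `C j`: `(2K/δ)² ≤ 25K²/(ρ - r)²`
        have hρ : 0 < pairDist i j t - r := by linarith [ht.1]
        have hreal : (2 * K / δ) ^ 2 ≤ 25 * K ^ 2 / (pairDist i j t - r) ^ 2 := by
          rw [div_pow, div_le_div_iff₀ (by positivity) (by positivity)]
          have h4 : 4 * (pairDist i j t - r) ^ 2 ≤ 25 * δ ^ 2 := by nlinarith [ht.1, ht.2, hρ]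
          nlinarith [h4, sq_nonneg K]
        calc ENNReal.ofReal (2 * K / δ) ^ 2 * ‖η t‖ₑ ^ 2
            ≤ ENNReal.ofReal (25 * K ^ 2 / (pairDist i j t - r) ^ 2) * ‖η t‖ₑ ^ 2 := by
              rw [← ENNReal.ofReal_pow (div_nonneg (mul_nonneg zero_le_two hK) hδ.le)]
              exact mul_le_mul_left (ENNReal.ofReal_le_ofReal hreal) _
          _ = ENNReal.ofReal (25 * K ^ 2) * (‖η t‖ₑ ^ 2 / ENNReal.ofReal ((pairDist i j t - r) ^ 2)) := by
              rw [ENNReal.ofReal_div_of_pos (by positivity), ENNReal.div_eq_inv_mul, ENNReal.div_eq_inv_mul]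
              ring
    _ = _ := by rw [← Finset.mul_sum]

/-! ## The kinetic estimate for the cut-off function -/

/-- **Kinetic energy of `χ_δ η` along `𝐞_{(i,k)}`.** For a cut profile `θ` (constant `K`),
`η ∈ L²((ℝ/ℤ)^{N×3}; ℂ)`, `0 < δ`, `ε > 0`:
`∑ₙ n_{(i,k)}² ‖𝓕(χ_δ η)(n)‖ₑ² ≤ (1+ε) ∑ₙ n_{(i,k)}² ‖η̂(n)‖ₑ²
  + (1+ε⁻¹)(4π²)⁻¹ N · 25K² ∑ⱼ ∫⁻_{C_{ij}(δ)} ‖η‖ₑ²/(ρᵢⱼ - r)²`, `C_{ij}(δ) = {r + δ/2 < ρᵢⱼ < r + 5δ/2}`.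
[folklore] -/
theorem tsum_sq_pairCutoff_mul_le (hθ : IsCutProfile K θ) {r δ : ℝ} (hδ : 0 < δ) (i : Fin N) (k : Fin 3)
    {η : UnitAddTorus (Fin N × Fin 3) → ℂ} (hη : MemLp η 2 volume) {ε : ℝ} (hε : 0 < ε) :
    ∑' n : Fin N × Fin 3 → ℤ, ENNReal.ofReal ((n (i, k) : ℝ) ^ 2) *
        ‖mFourierCoeff (fun t => (pairCutoff θ r δ t : ℂ) * η t) n‖ₑ ^ 2 ≤
      ENNReal.ofReal (1 + ε) * ∑' n : Fin N × Fin 3 → ℤ, ENNReal.ofReal ((n (i, k) : ℝ) ^ 2) * ‖mFourierCoeff η n‖ₑ ^ 2 +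
        ENNReal.ofReal (1 + ε⁻¹) * ENNReal.ofReal (1 / (2 * Real.pi) ^ 2) *
          ((N : ℝ≥0∞) * (ENNReal.ofReal (25 * (K : ℝ) ^ 2) *
            ∑ j : Fin N, ∫⁻ t in {t | r + δ / 2 < pairDist i j t ∧ pairDist i j t < r + 5 * δ / 2},
              ‖η t‖ₑ ^ 2 / ENNReal.ofReal ((pairDist i j t - r) ^ 2))) := by
  have hχm : AEStronglyMeasurable (fun t : UnitAddTorus (Fin N × Fin 3) => (pairCutoff θ r δ t : ℂ)) volume :=
    (Complex.continuous_ofReal.comp (continuous_pairCutoff hθ r δ)).aestronglyMeasurable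
  have hB : ∀ t : UnitAddTorus (Fin N × Fin 3), ‖(pairCutoff θ r δ t : ℂ)‖ ≤ ((1 : ℝ≥0) : ℝ) := fun t => by
    rw [NNReal.coe_one, Complex.norm_real, Real.norm_eq_abs]
    exact abs_pairCutoff_le_one hθ r δ t
  have hmain := tsum_sq_mul_enorm_mFourierCoeff_mul_le hχm hB hη (i, k) (half_pos hδ)
    (fun t s hs => enorm_pairCutoff_add_single_sub_le (r := r) hθ hδ i k t hs) hε
  simp only [ENNReal.coe_one, one_pow, mul_one] at hmain
  exact hmain.trans (add_le_add_right (mul_le_mul_right (lintegral_modulus_sq_mul_le hδ K.coe_nonneg i hη.1) _) _)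

/-! ## The collar integrals vanish in the limit -/

/-- **The collar integrals tend to zero.** If `0 < r` and
`∫⁻_{r < ρᵢⱼ < 6r/5} ‖η‖ₑ²/(ρᵢⱼ - r)² < ∞` then
`∫⁻_{r + δ/2 < ρᵢⱼ < r + 5δ/2} ‖η‖ₑ²/(ρᵢⱼ - r)² → 0` as `δ → 0⁺` (dominated convergence: for
`δ ≤ 2r/25` the collar `C_{ij}(δ)` lies in `{r < ρᵢⱼ < 6r/5}`, and every point leaves `C_{ij}(δ)`
eventually). [folklore] -/
theorem tendsto_collar_lintegral_zero {r : ℝ} (hr : 0 < r) (i j : Fin N)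
    {η : UnitAddTorus (Fin N × Fin 3) → ℂ} (hη : AEStronglyMeasurable η volume)
    (hfin : ∫⁻ t in {t | r < pairDist i j t ∧ pairDist i j t < 6 / 5 * r},
      ‖η t‖ₑ ^ 2 / ENNReal.ofReal ((pairDist i j t - r) ^ 2) ≠ ⊤) :
    Tendsto (fun δ : ℝ => ∫⁻ t in {t | r + δ / 2 < pairDist i j t ∧ pairDist i j t < r + 5 * δ / 2},
      ‖η t‖ₑ ^ 2 / ENNReal.ofReal ((pairDist i j t - r) ^ 2)) (𝓝[>] 0) (𝓝 0) := by
  set F₀ : UnitAddTorus (Fin N × Fin 3) → ℝ≥0∞ := fun t =>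
    ‖η t‖ₑ ^ 2 / ENNReal.ofReal ((pairDist i j t - r) ^ 2) with hF₀
  set K : Set (UnitAddTorus (Fin N × Fin 3)) := {t | r < pairDist i j t ∧ pairDist i j t < 6 / 5 * r} with hK
  set C : ℝ → Set (UnitAddTorus (Fin N × Fin 3)) := fun δ =>
    {t | r + δ / 2 < pairDist i j t ∧ pairDist i j t < r + 5 * δ / 2} with hC
  have hpd : Measurable (pairDist (N := N) i j) := (continuous_pairDist i j).measurable
  have hCm : ∀ δ, MeasurableSet (C δ) := fun δ =>
    (measurableSet_lt measurable_const hpd).inter (measurableSet_lt hpd measurable_const)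
  have hKm : MeasurableSet K := (measurableSet_lt measurable_const hpd).inter (measurableSet_lt hpd measurable_const)
  have hF₀m : AEMeasurable F₀ volume :=
    (hη.enorm.pow_const 2).div ((hpd.sub_const r).pow_const 2).ennreal_ofReal.aemeasurable
  -- rewrite the set integrals as integrals of indicators
  have hgoal : (fun δ : ℝ => ∫⁻ t in C δ, F₀ t) = fun δ => ∫⁻ t, (C δ).indicator F₀ t :=
    funext fun δ => (lintegral_indicator (hCm δ) _).symm
  show Tendsto (fun δ : ℝ => ∫⁻ t in C δ, F₀ t) (𝓝[>] 0) (𝓝 0)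
  rw [hgoal, show (0 : ℝ≥0∞) = ∫⁻ _t : UnitAddTorus (Fin N × Fin 3), (0 : ℝ≥0∞) by rw [lintegral_zero]]
  refine tendsto_lintegral_filter_of_dominated_convergence' (K.indicator F₀) ?_ ?_ ?_ ?_
  · exact Eventually.of_forall fun δ => hF₀m.indicator (hCm δ)
  · -- for `0 < δ ≤ 2r/25` the collar lies in `K`
    have hev : ∀ᶠ δ in 𝓝[>] (0 : ℝ), δ ∈ Ioo 0 (2 * r / 25) := Ioo_mem_nhdsGT (by positivity)
    filter_upwards [hev] with δ hδ
    have hsub : C δ ⊆ K := fun t ht => ⟨by linarith [ht.1, hδ.1], by linarith [ht.2, hδ.2]⟩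
    exact ae_of_all _ fun t => indicator_le_indicator_of_subset hsub (fun _ => zero_le) t
  · rwa [lintegral_indicator hKm]
  · refine ae_of_all _ fun t => ?_
    -- every point leaves `C δ` eventually
    have hev : ∀ᶠ δ in 𝓝[>] (0 : ℝ), (C δ).indicator F₀ t = 0 := by
      by_cases ht : pairDist i j t ≤ r
      · refine Eventually.of_forall fun δ => indicator_of_notMem (fun h => ?_) _
        have hδ2 : r + δ / 2 < pairDist i j t := h.1
        have : pairDist i j t < r + 5 * δ / 2 := h.2
        nlinarith
      · have hpos : 0 < 2 / 5 * (pairDist i j t - r) := by nlinarith [not_le.1 ht]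
        have hev' : ∀ᶠ δ in 𝓝[>] (0 : ℝ), δ < 2 / 5 * (pairDist i j t - r) :=
          eventually_nhdsWithin_of_eventually_nhds (eventually_lt_nhds hpos)
        filter_upwards [hev'] with δ hδ
        refine indicator_of_notMem (fun h => ?_) _
        have : pairDist i j t < r + 5 * δ / 2 := h.2
        nlinarith
    exact tendsto_const_nhds.congr' (hev.mono fun δ hδ => hδ.symm)

/-! ## `χ_δ η → η` in `L²` -/

/-- **The cut-off functions converge in `L²`**: if `η ∈ L²` vanishes a.e. on the closed tubes
`{ρᵢⱼ ≤ r}` (`i < j`), then `∫⁻ ‖χ_δ η - η‖² → 0` as `δ → 0⁺` (`|χ_δ - 1| ≤ 1`, and off the closed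
tubes `χ_δ = 1` for small `δ`; dominated convergence). [folklore] -/
theorem tendsto_lintegral_pairCutoff_mul_sub_sq (hθ : IsCutProfile K θ) {r : ℝ}
    {η : UnitAddTorus (Fin N × Fin 3) → ℂ} (hη : MemLp η 2 volume)
    (hη0 : ∀ᵐ t ∂(volume : Measure (UnitAddTorus (Fin N × Fin 3))),
      (∃ i j : Fin N, i < j ∧ pairDist i j t ≤ r) → η t = 0) :
    Tendsto (fun δ : ℝ => ∫⁻ t, ‖(pairCutoff θ r δ t : ℂ) * η t - η t‖ₑ ^ 2) (𝓝[>] 0) (𝓝 0) := by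
  have hpt : ∀ δ t, ‖(pairCutoff θ r δ t : ℂ) * η t - η t‖ₑ ^ 2 ≤ ‖η t‖ₑ ^ 2 := by
    intro δ t
    have h1 : (pairCutoff θ r δ t : ℂ) * η t - η t = ((pairCutoff θ r δ t - 1 : ℝ) : ℂ) * η t := by
      push_cast; ring
    rw [h1, enorm_mul, mul_pow]
    refine mul_le_of_le_one_left' (pow_le_one' ?_ 2)
    rw [← ofReal_norm, Complex.norm_real, Real.norm_eq_abs, ← ENNReal.ofReal_one]
    refine ENNReal.ofReal_le_ofReal (abs_le.2 ⟨?_, ?_⟩)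
    · linarith [pairCutoff_nonneg hθ r δ t]
    · linarith [pairCutoff_le_one hθ r δ t]
  rw [show (0 : ℝ≥0∞) = ∫⁻ _t : UnitAddTorus (Fin N × Fin 3), (0 : ℝ≥0∞) by rw [lintegral_zero]]
  refine tendsto_lintegral_filter_of_dominated_convergence' (fun t => ‖η t‖ₑ ^ 2) ?_ ?_ ?_ ?_
  · refine Eventually.of_forall fun δ => ?_
    exact (((Complex.continuous_ofReal.comp (continuous_pairCutoff hθ r δ)).aestronglyMeasurable.mul hη.1).sub
      hη.1).enorm.pow_const 2
  · exact Eventually.of_forall fun δ => ae_of_all _ (hpt δ)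
  · exact (lintegral_enorm_sq_lt_top_of_memLp hη).ne
  · filter_upwards [hη0] with t ht
    have hev : ∀ᶠ δ in 𝓝[>] (0 : ℝ), ‖(pairCutoff θ r δ t : ℂ) * η t - η t‖ₑ ^ 2 = 0 := by
      by_cases hZ : ∃ i j : Fin N, i < j ∧ pairDist i j t ≤ r
      · refine Eventually.of_forall fun δ => ?_
        rw [ht hZ, mul_zero, sub_zero, enorm_zero, zero_pow two_ne_zero]
      · push Not at hZ
        -- off the closed tubes: eventually `χ_δ t = 1`
        have hall : ∀ᶠ δ in 𝓝[>] (0 : ℝ), ∀ q : Fin N × Fin N, q.1 < q.2 → r + 2 * δ ≤ pairDist q.1 q.2 t := by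
          refine eventually_all.2 fun q => ?_
          by_cases hq : q.1 < q.2
          · have hpos : 0 < (pairDist q.1 q.2 t - r) / 2 := by linarith [hZ q.1 q.2 hq]
            have hev' : ∀ᶠ δ in 𝓝[>] (0 : ℝ), δ < (pairDist q.1 q.2 t - r) / 2 :=
              eventually_nhdsWithin_of_eventually_nhds (eventually_lt_nhds hpos)
            filter_upwards [hev'] with δ hδ _
            linarith
          · exact Eventually.of_forall fun δ h => absurd h hq
        have hpos : ∀ᶠ δ in 𝓝[>] (0 : ℝ), 0 < δ := eventually_mem_nhdsWithin
        filter_upwards [hall, hpos] with δ hδ hδ0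
        rw [pairCutoff_eq_one hθ hδ0 (fun i j hij => hδ (i, j) hij), Complex.ofReal_one, one_mul, sub_self,
          enorm_zero, zero_pow two_ne_zero]
    exact tendsto_const_nhds.congr' (hev.mono fun δ hδ => hδ.symm)

/-! ## Packaging: cutting off the tubes costs arbitrarily little energy -/

/-- The tube-Hardy integral of the diagonal pair `(i, i)` vanishes (`ρᵢᵢ = 0 < r`). [folklore] -/
theorem lintegral_collar_self_eq_zero {r : ℝ} (hr : 0 < r) (i : Fin N) (F : UnitAddTorus (Fin N × Fin 3) → ℝ≥0∞) :
    ∫⁻ t in {t | r < pairDist i i t ∧ pairDist i i t < 6 / 5 * r}, F t = 0 := by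
  have hempty : {t : UnitAddTorus (Fin N × Fin 3) | r < pairDist i i t ∧ pairDist i i t < 6 / 5 * r} = ∅ := by
    ext t
    simp only [mem_setOf_eq, mem_empty_iff_false, iff_false, not_and]
    intro h
    have h0 : pairDist i i t = 0 := by simp [pairDist]
    linarith
  rw [hempty, Measure.restrict_empty, lintegral_zero_measure]

/-- **The kinetic error of the cut-off vanishes as `δ → 0⁺`**: in the direction `q = (i,k)`, the
error term `(1+ε⁻¹)(4π²)⁻¹ · N · 25K² ∑ⱼ ∫⁻_{C_{ij}(δ)} ‖η‖²/(ρᵢⱼ - r)²` of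
`Torus.tsum_sq_pairCutoff_mul_le` tends to `0`, given finite tube-Hardy integrals. [folklore] -/
theorem tendsto_kinetic_error_zero {r : ℝ} (hr : 0 < r) (i : Fin N)
    {η : UnitAddTorus (Fin N × Fin 3) → ℂ} (hη : AEStronglyMeasurable η volume)
    (hfin : ∀ j : Fin N, i ≠ j → ∫⁻ t in {t | r < pairDist i j t ∧ pairDist i j t < 6 / 5 * r},
      ‖η t‖ₑ ^ 2 / ENNReal.ofReal ((pairDist i j t - r) ^ 2) ≠ ⊤) (A B : ℝ≥0∞) (hA : A ≠ ⊤) (hB : B ≠ ⊤) :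
    Tendsto (fun δ : ℝ => A * ((N : ℝ≥0∞) * (B *
        ∑ j : Fin N, ∫⁻ t in {t | r + δ / 2 < pairDist i j t ∧ pairDist i j t < r + 5 * δ / 2},
          ‖η t‖ₑ ^ 2 / ENNReal.ofReal ((pairDist i j t - r) ^ 2)))) (𝓝[>] 0) (𝓝 0) := by
  have hsum : Tendsto (fun δ : ℝ => ∑ j : Fin N,
      ∫⁻ t in {t | r + δ / 2 < pairDist i j t ∧ pairDist i j t < r + 5 * δ / 2},
        ‖η t‖ₑ ^ 2 / ENNReal.ofReal ((pairDist i j t - r) ^ 2)) (𝓝[>] 0) (𝓝 0) := by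
    have hf : ∀ j : Fin N, ∫⁻ t in {t | r < pairDist i j t ∧ pairDist i j t < 6 / 5 * r},
        ‖η t‖ₑ ^ 2 / ENNReal.ofReal ((pairDist i j t - r) ^ 2) ≠ ⊤ := by
      intro j
      rcases eq_or_ne i j with h | h
      · subst h
        rw [lintegral_collar_self_eq_zero hr]
        exact ENNReal.zero_ne_top
      · exact hfin j h
    have h := tendsto_finsetSum (Finset.univ : Finset (Fin N))
      (fun j _ => tendsto_collar_lintegral_zero hr i j hη (hf j))
    simpa only [Finset.sum_const_zero] using h
  have h1 : Tendsto (fun δ : ℝ => B * ∑ j : Fin N,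
      ∫⁻ t in {t | r + δ / 2 < pairDist i j t ∧ pairDist i j t < r + 5 * δ / 2},
        ‖η t‖ₑ ^ 2 / ENNReal.ofReal ((pairDist i j t - r) ^ 2)) (𝓝[>] 0) (𝓝 0) := by
    simpa only [mul_zero] using ENNReal.Tendsto.const_mul hsum (Or.inr hB)
  have h2 := ENNReal.Tendsto.const_mul h1 (Or.inr (ENNReal.natCast_ne_top N))
  rw [mul_zero] at h2
  simpa only [mul_zero] using ENNReal.Tendsto.const_mul h2 (Or.inr hA)

/-- **Cutting off the hard-core tubes costs arbitrarily little energy.** Let `θ` be a cut profile,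
`0 < r`, `η ∈ L²((ℝ/ℤ)^{N×3}; ℂ)` with `η = 0` a.e. on `{∃ i<j, ρᵢⱼ ≤ r}` and finite tube-Hardy
integrals `∫⁻_{r<ρᵢⱼ<6r/5} ‖η‖²/(ρᵢⱼ-r)² < ∞` (`i ≠ j`), and `ε > 0`. Then for all sufficiently small
`δ > 0`, `ζ_δ = χ_δ η` (`χ_δ = pairCutoff θ r δ`) has
`∑ₙ n_q² ‖ζ̂_δ(n)‖² ≤ (1+ε) ∑ₙ n_q² ‖η̂(n)‖² + ε` for every direction `q`, and `∫⁻ ‖ζ_δ - η‖² ≤ ε`.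
[folklore] -/
theorem eventually_pairCutoff_regularization (hθ : IsCutProfile K θ) {r : ℝ} (hr : 0 < r)
    {η : UnitAddTorus (Fin N × Fin 3) → ℂ} (hη : MemLp η 2 volume)
    (hfin : ∀ i j : Fin N, i ≠ j → ∫⁻ t in {t | r < pairDist i j t ∧ pairDist i j t < 6 / 5 * r},
      ‖η t‖ₑ ^ 2 / ENNReal.ofReal ((pairDist i j t - r) ^ 2) ≠ ⊤)
    (hη0 : ∀ᵐ t ∂(volume : Measure (UnitAddTorus (Fin N × Fin 3))),
      (∃ i j : Fin N, i < j ∧ pairDist i j t ≤ r) → η t = 0)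
    {ε : ℝ} (hε : 0 < ε) :
    ∀ᶠ δ in 𝓝[>] (0 : ℝ),
      (∀ q : Fin N × Fin 3,
        ∑' n : Fin N × Fin 3 → ℤ, ENNReal.ofReal ((n q : ℝ) ^ 2) *
            ‖mFourierCoeff (fun t => (pairCutoff θ r δ t : ℂ) * η t) n‖ₑ ^ 2 ≤
          ENNReal.ofReal (1 + ε) * ∑' n : Fin N × Fin 3 → ℤ, ENNReal.ofReal ((n q : ℝ) ^ 2) * ‖mFourierCoeff η n‖ₑ ^ 2 +
            ENNReal.ofReal ε) ∧
      ∫⁻ t, ‖(pairCutoff θ r δ t : ℂ) * η t - η t‖ₑ ^ 2 ≤ ENNReal.ofReal ε := by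
  have hεpos : (0 : ℝ≥0∞) < ENNReal.ofReal ε := ENNReal.ofReal_pos.2 hε
  -- the kinetic error, direction by direction
  have hkin : ∀ q : Fin N × Fin 3, ∀ᶠ δ in 𝓝[>] (0 : ℝ),
      ∑' n : Fin N × Fin 3 → ℤ, ENNReal.ofReal ((n q : ℝ) ^ 2) *
          ‖mFourierCoeff (fun t => (pairCutoff θ r δ t : ℂ) * η t) n‖ₑ ^ 2 ≤
        ENNReal.ofReal (1 + ε) * ∑' n : Fin N × Fin 3 → ℤ, ENNReal.ofReal ((n q : ℝ) ^ 2) * ‖mFourierCoeff η n‖ₑ ^ 2 +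
          ENNReal.ofReal ε := by
    rintro ⟨i, k⟩
    have ht := tendsto_kinetic_error_zero hr i hη.1 (fun j hj => hfin i j hj)
      (ENNReal.ofReal (1 + ε⁻¹) * ENNReal.ofReal (1 / (2 * Real.pi) ^ 2)) (ENNReal.ofReal (25 * (K : ℝ) ^ 2))
      (ENNReal.mul_ne_top ENNReal.ofReal_ne_top ENNReal.ofReal_ne_top) ENNReal.ofReal_ne_top
    have hev := ht (Iio_mem_nhds hεpos)
    have hpos : ∀ᶠ δ in 𝓝[>] (0 : ℝ), 0 < δ := eventually_mem_nhdsWithin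
    filter_upwards [hev, hpos] with δ hδ hδ0
    refine (tsum_sq_pairCutoff_mul_le hθ hδ0 i k hη hε).trans ?_
    exact add_le_add_right (le_of_lt hδ) _
  -- the `L²` error
  have hL2 : ∀ᶠ δ in 𝓝[>] (0 : ℝ), ∫⁻ t, ‖(pairCutoff θ r δ t : ℂ) * η t - η t‖ₑ ^ 2 ≤ ENNReal.ofReal ε := by
    have ht := tendsto_lintegral_pairCutoff_mul_sub_sq hθ (r := r) hη hη0
    filter_upwards [ht (Iio_mem_nhds hεpos)] with δ hδ
    exact le_of_lt hδ
  exact (eventually_all.2 hkin).and hL2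

end Torus

end Literature.Analysis.FunctionSpaces

end
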